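import Mathlib
import HarnessLib

/-!
# Hardy–Littlewood–Chowla on average (Lichtman–Teräväinen 2022): counting coincident tuples

Topic `Literature/NumberTheory/Sieve`, companion of `HardyLittlewoodChowla.lean` (the named facts
`lichtmanTeravainen2022_hlc_avg(_liouville)` = J. D. Lichtman, J. Teräväinen, *On the
Hardy–Littlewood–Chowla conjecture on average*, Forum Math. Sigma 10 (2022) e57, arXiv:2111.08912
[LichtmanTeravainen2022], Theorem 1.2 (i)).  Everything in this file is PROVED; it contains only
elementary combinatorics (no number theory) and no named fact.

This is the combinatorial core of the proof of **Proposition 2.7** of the paper (held copy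
`paper:arxiv-2111.08912`, §2.2): after expanding the `2k`-th moment of the short exponential sum over
prime tuples and applying an upper-bound sieve, one is left (displays (2.7)–(2.9) of the paper) with
counting the offset vectors `(h₁, …, h_{2k-1})` of a `2k`-tuple in a window of length `H`, subject to
the balance relation `h₁ + ⋯ + h_k = h_{k+1} + ⋯ + h_{2k-1}`, according to the number of coincidences
among the shifts `a_j + h_i`; the paper's claim is
`|I| ≥ ⌈m/ℓ⌉` for `I = {i : ∃ i' > i, |h_i - h_{i'}| ≤ A}` and, "by basic linear algebra",
`#{h : |𝒜 + ℋ| = 2kℓ - m} ≪ H^{2k-2-⌈m/ℓ⌉+𝟙_{m > (k-1)ℓ}}`.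

We formalise this through the complementary set of **leaders** (indices whose value is far from all
later values; the complement of the paper's `I`):

* `leaders D x` — the indices `i` with `|x i - x i'| > D` for every later `i'`;
  `card_mul_card_leaders_le` — for a shift set `A` of diameter `≤ D`, the shifts `x i + a`
  (`i` a leader, `a ∈ A`) are pairwise distinct, so `#A · #leaders ≤ #{x i + a}` (the paper's
  "`|I| ≥ ⌈m/ℓ⌉`");
* `jump`, `leaderRoot` — every index reaches a leader by repeatedly jumping to a later index at distance
  `≤ D` (`leaderRoot_mem_leaders`, `abs_sub_leaderRoot_le`: `|x i - x (leaderRoot i)| ≤ m D`);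
* `two_mul_card_leaders_le` — the parity observation replacing the paper's linear algebra: if every
  leaderRoot class is balanced for a `±1` sign vector then it has even size `≥ 2`, so `2 #leaders ≤ m`;
* `card_pinned_balanced_le` — **the count**: the vectors `x ∈ [1, B]^m` with `∑ sᵢ xᵢ = 0`
  (`s = ±1`, `∑ sᵢ = 0`), last coordinate pinned and exactly `c` leaders number at most
  `C(m, D) (B + 1)^{c - 1 - 𝟙[m < 2c]}` — proved by the injection
  `x ↦ ((leaders, leaderRoot, x - x ∘ leaderRoot, pivot), free leader values)`, the pinned leader and one pivot
  leader with non-zero class sum (which exists when `m < 2c`) being recovered from the data and the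
  balance relation.

## References

* J. D. Lichtman, J. Teräväinen, Forum Math. Sigma 10 (2022) e57, arXiv:2111.08912, §2.2, proof of
  Proposition 2.7, displays (2.7)–(2.9). [cite: LichtmanTeravainen2022, Proposition 2.7 (proof)]
-/

open Finset

namespace Literature.NumberTheory.Sieve.LichtmanTeravainen2022

variable {m : ℕ}

/-! ### Leaders -/

/-- The **leaders** of `x : Fin m → ℤ` at distance `D`: the indices `i` such that every later value
is at distance `> D` from `x i` (the complement of the set `𝓘` of the proof of
[LichtmanTeravainen2022, Prop. 2.7]). [cite: LichtmanTeravainen2022, Proposition 2.7 (proof)] -/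
def leaders (D : ℤ) (x : Fin m → ℤ) : Finset (Fin m) :=
  univ.filter fun i => ∀ i' : Fin m, i < i' → D < |x i - x i'|

/-- Membership in `leaders`. [folklore] -/
theorem mem_leaders {D : ℤ} {x : Fin m → ℤ} {i : Fin m} :
    i ∈ leaders D x ↔ ∀ i' : Fin m, i < i' → D < |x i - x i'| := by
  simp [leaders]

/-- A maximal index is a leader. [folklore] -/
theorem mem_leaders_of_forall_le {D : ℤ} {x : Fin m → ℤ} {i : Fin m} (h : ∀ i', i' ≤ i) :
    i ∈ leaders D x :=
  mem_leaders.2 fun i' hi' => absurd (h i') (not_le.2 hi')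

/-- **The paper's "`|𝓘| ≥ ⌈m/ℓ⌉`"**: if `A` has diameter `≤ D`, the shifts `x i + a` with `i` a
leader and `a ∈ A` are pairwise distinct, whence `#A · #leaders ≤ #{x i + a : i, a ∈ A}`.
[cite: LichtmanTeravainen2022, Proposition 2.7 (proof)] -/
theorem card_mul_card_leaders_le (A : Finset ℤ) (D : ℤ) (hA : ∀ a ∈ A, ∀ a' ∈ A, |a - a'| ≤ D)
    (x : Fin m → ℤ) :
    #A * #(leaders D x) ≤ #((univ ×ˢ A).image fun p : Fin m × ℤ => x p.1 + p.2) := by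
  classical
  set T := (univ ×ˢ A).image fun p : Fin m × ℤ => x p.1 + p.2 with hT
  have hsub : (leaders D x).biUnion (fun r => A.image fun a => x r + a) ⊆ T := by
    intro z hz
    simp only [Finset.mem_biUnion, Finset.mem_image] at hz
    obtain ⟨r, -, a, ha, rfl⟩ := hz
    exact Finset.mem_image.2 ⟨(r, a), Finset.mem_product.2 ⟨Finset.mem_univ _, ha⟩, rfl⟩
  have hdisj : ((leaders D x : Finset (Fin m)) : Set (Fin m)).PairwiseDisjoint
      (fun r => A.image fun a => x r + a) := by
    intro r hr r' hr' hne
    rw [Function.onFun, Finset.disjoint_left]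
    intro z hz hz'
    simp only [Finset.mem_image] at hz hz'
    obtain ⟨a, ha, rfl⟩ := hz
    obtain ⟨a', ha', heq⟩ := hz'
    have hd : |x r - x r'| ≤ D := by
      have : x r - x r' = a' - a := by linarith
      rw [this]; exact hA a' ha' a ha
    rcases lt_or_gt_of_ne hne with h | h
    · exact absurd hd (not_le.2 ((mem_leaders.1 hr) r' h))
    · have := (mem_leaders.1 hr') r h
      rw [abs_sub_comm] at this
      exact absurd hd (not_le.2 this)
  calc #A * #(leaders D x) = ∑ r ∈ leaders D x, #(A.image fun a => x r + a) := by
        rw [Finset.sum_congr rfl fun r _ =>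
          Finset.card_image_of_injective _ (add_right_injective (x r)),
          Finset.sum_const, smul_eq_mul, mul_comm]
    _ = #((leaders D x).biUnion fun r => A.image fun a => x r + a) :=
        (Finset.card_biUnion hdisj).symm
    _ ≤ #T := Finset.card_le_card hsub

/-! ### Jumping to a later laterClose index; roots -/

/-- The later indices at distance `≤ D` from `x i`. [folklore] -/
def laterClose (D : ℤ) (x : Fin m → ℤ) (i : Fin m) : Finset (Fin m) :=
  univ.filter fun i' => i < i' ∧ |x i - x i'| ≤ D

/-- `i` is not a leader iff it has a later laterClose index. [folklore] -/
theorem not_mem_leaders_iff {D : ℤ} {x : Fin m → ℤ} {i : Fin m} :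
    i ∉ leaders D x ↔ (laterClose D x i).Nonempty := by
  rw [mem_leaders]
  simp only [laterClose, Finset.filter_nonempty_iff, Finset.mem_univ, true_and, not_forall, not_lt,
    exists_prop]

/-- The jump map: a non-leader goes to its first later laterClose index, a leader stays.
[folklore] -/
def jump (D : ℤ) (x : Fin m → ℤ) (i : Fin m) : Fin m :=
  if h : (laterClose D x i).Nonempty then (laterClose D x i).min' h else i

/-- Leaders are fixed by `jump`. [folklore] -/
theorem jump_of_mem {D : ℤ} {x : Fin m → ℤ} {i : Fin m} (h : i ∈ leaders D x) :
    jump D x i = i := by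
  have h' : ¬ (laterClose D x i).Nonempty := fun hn => (not_mem_leaders_iff.2 hn) h
  simp [jump, h']

/-- A non-leader jumps strictly forward, to a laterClose index. [folklore] -/
theorem lt_jump_and {D : ℤ} {x : Fin m → ℤ} {i : Fin m} (h : i ∉ leaders D x) :
    i < jump D x i ∧ |x i - x (jump D x i)| ≤ D := by
  have hn : (laterClose D x i).Nonempty := not_mem_leaders_iff.1 h
  have hmem : (laterClose D x i).min' hn ∈ laterClose D x i := Finset.min'_mem _ hn
  simp only [jump, hn, dif_pos]
  simp only [laterClose, Finset.mem_filter, Finset.mem_univ, true_and] at hmem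
  exact hmem

/-- Every jump moves the value by at most `D` (`D ≥ 0`). [folklore] -/
theorem abs_sub_jump_le {D : ℤ} (hD : 0 ≤ D) (x : Fin m → ℤ) (i : Fin m) :
    |x i - x (jump D x i)| ≤ D := by
  by_cases h : i ∈ leaders D x
  · rw [jump_of_mem h, sub_self, abs_zero]; exact hD
  · exact (lt_jump_and h).2

/-- The **leaderRoot** of `i`: the leader reached after (at most) `m` jumps. [folklore] -/
def leaderRoot (D : ℤ) (x : Fin m → ℤ) (i : Fin m) : Fin m :=
  (jump D x)^[m] i

/-- The leaderRoot is a leader. [folklore] -/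
theorem leaderRoot_mem_leaders (D : ℤ) (x : Fin m → ℤ) (i : Fin m) : leaderRoot D x i ∈ leaders D x := by
  have key : ∀ k : ℕ, (jump D x)^[k] i ∉ leaders D x → (i : ℕ) + k ≤ ((jump D x)^[k] i : ℕ) := by
    intro k
    induction k with
    | zero => intro _; simp
    | succ k ih =>
      intro hk
      rw [Function.iterate_succ_apply'] at hk ⊢
      have hk' : (jump D x)^[k] i ∉ leaders D x := by
        intro hmem
        rw [jump_of_mem hmem] at hk
        exact hk hmem
      have h1 := ih hk'
      have h2 : (jump D x)^[k] i < jump D x ((jump D x)^[k] i) := (lt_jump_and hk').1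
      rw [Fin.lt_def] at h2
      omega
  by_contra h
  have h1 := key m h
  have h2 := ((jump D x)^[m] i).isLt
  unfold leaderRoot at h
  omega

/-- Leaders are their own roots. [folklore] -/
theorem leaderRoot_of_mem {D : ℤ} {x : Fin m → ℤ} {i : Fin m} (h : i ∈ leaders D x) :
    leaderRoot D x i = i :=
  Function.iterate_fixed (jump_of_mem h) m

/-- The value at the leaderRoot is within `m D` of the value at `i`. [folklore] -/
theorem abs_sub_leaderRoot_le {D : ℤ} (hD : 0 ≤ D) (x : Fin m → ℤ) (i : Fin m) :
    |x i - x (leaderRoot D x i)| ≤ m * D := by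
  have key : ∀ k : ℕ, |x i - x ((jump D x)^[k] i)| ≤ k * D := by
    intro k
    induction k with
    | zero => simp
    | succ k ih =>
      rw [Function.iterate_succ_apply']
      calc |x i - x (jump D x ((jump D x)^[k] i))|
          ≤ |x i - x ((jump D x)^[k] i)| +
              |x ((jump D x)^[k] i) - x (jump D x ((jump D x)^[k] i))| := abs_sub_le _ _ _
        _ ≤ k * D + D := add_le_add ih (abs_sub_jump_le hD x _)
        _ = (k + 1 : ℕ) * D := by push_cast; ring
  exact key m

/-! ### Root classes and the parity observation -/

/-- The signed size `α_r = ∑_{leaderRoot i = r} sᵢ` of the leaderRoot class of `r`. [folklore] -/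
def classSum (D : ℤ) (x : Fin m → ℤ) (s : Fin m → ℤ) (r : Fin m) : ℤ :=
  ∑ i ∈ univ.filter (fun i => leaderRoot D x i = r), s i

/-- The whole index set is the disjoint union of the leaderRoot classes of the leaders, so a function
summed over all indices is summed class by class. [folklore] -/
theorem sum_eq_sum_leaders_sum_class {M : Type*} [AddCommMonoid M] (D : ℤ) (x : Fin m → ℤ)
    (f : Fin m → M) :
    ∑ i, f i = ∑ r ∈ leaders D x, ∑ i ∈ univ.filter (fun i => leaderRoot D x i = r), f i := by
  rw [← Finset.sum_fiberwise_of_maps_to (g := leaderRoot D x) (t := leaders D x)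
    (fun i _ => leaderRoot_mem_leaders D x i)]

/-- A `±1`-vector summing to zero over a finite set forces the set to have even size; a leaderRoot class
contains its leaderRoot, so a balanced leaderRoot class has at least two elements. [folklore] -/
theorem two_le_card_class {D : ℤ} {x : Fin m → ℤ} {s : Fin m → ℤ}
    (hs : ∀ i, s i = 1 ∨ s i = -1) {r : Fin m} (hr : r ∈ leaders D x)
    (h0 : classSum D x s r = 0) :
    2 ≤ #(univ.filter (fun i => leaderRoot D x i = r)) := by
  set F := univ.filter (fun i => leaderRoot D x i = r) with hF
  have hrF : r ∈ F := by simp [hF, leaderRoot_of_mem hr]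
  set P := F.filter (fun i => s i = 1) with hP
  set N := F.filter (fun i => ¬ s i = 1) with hN
  have hPN : #P + #N = #F := Finset.card_filter_add_card_filter_not _
  have hsumF : classSum D x s r = (#P : ℤ) - #N := by
    unfold classSum
    rw [← hF, ← Finset.sum_filter_add_sum_filter_not F (fun i => s i = 1)]
    have h1 : ∑ i ∈ P, s i = #P := by
      rw [Finset.card_eq_sum_ones, Nat.cast_sum, Nat.cast_one]
      exact Finset.sum_congr rfl fun i hi => (Finset.mem_filter.1 hi).2
    have h2 : ∑ i ∈ N, s i = -#N := by
      rw [Finset.card_eq_sum_ones, Nat.cast_sum, Nat.cast_one, ← Finset.sum_neg_distrib]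
      refine Finset.sum_congr rfl fun i hi => ?_
      have hi' := (Finset.mem_filter.1 hi).2
      rcases hs i with h | h
      · exact absurd h hi'
      · exact h
    rw [← hP, ← hN, h1, h2]
    ring
  have hF1 : 1 ≤ #F := Finset.card_pos.2 ⟨r, hrF⟩
  omega

/-- **Parity observation**: if every leaderRoot class is balanced for a `±1` sign vector, then
`2 · #leaders ≤ m`. [cite: LichtmanTeravainen2022, Proposition 2.7 (proof)] -/
theorem two_mul_card_leaders_le {D : ℤ} {x : Fin m → ℤ} {s : Fin m → ℤ}
    (hs : ∀ i, s i = 1 ∨ s i = -1) (h0 : ∀ r ∈ leaders D x, classSum D x s r = 0) :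
    2 * #(leaders D x) ≤ m := by
  have h1 : ∑ r ∈ leaders D x, #(univ.filter (fun i => leaderRoot D x i = r)) = m := by
    have := sum_eq_sum_leaders_sum_class D x (fun _ => (1 : ℕ))
    simp only [Finset.sum_const, smul_eq_mul, mul_one, Finset.card_univ, Fintype.card_fin] at this
    exact this.symm
  calc 2 * #(leaders D x) = ∑ r ∈ leaders D x, 2 := by rw [Finset.sum_const, smul_eq_mul, mul_comm]
    _ ≤ ∑ r ∈ leaders D x, #(univ.filter (fun i => leaderRoot D x i = r)) :=
        Finset.sum_le_sum fun r hr => two_le_card_class hs hr (h0 r hr)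
    _ = m := h1

/-- The class sums add up to `∑ sᵢ`. [folklore] -/
theorem sum_classSum (D : ℤ) (x : Fin m → ℤ) (s : Fin m → ℤ) :
    ∑ r ∈ leaders D x, classSum D x s r = ∑ i, s i :=
  (sum_eq_sum_leaders_sum_class D x s).symm

/-- When `m < 2 · #leaders` and `∑ sᵢ = 0`, some leader other than any prescribed one has a
non-zero class sum. [cite: LichtmanTeravainen2022, Proposition 2.7 (proof)] -/
theorem exists_classSum_ne_zero {D : ℤ} {x : Fin m → ℤ} {s : Fin m → ℤ}
    (hs : ∀ i, s i = 1 ∨ s i = -1) (hsum : ∑ i, s i = 0) (ilast : Fin m)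
    (hc : m < 2 * #(leaders D x)) :
    ∃ r ∈ leaders D x, r ≠ ilast ∧ classSum D x s r ≠ 0 := by
  by_contra hne
  push Not at hne
  have h1 : ∃ r ∈ leaders D x, classSum D x s r ≠ 0 := by
    by_contra h2
    push Not at h2
    exact absurd (two_mul_card_leaders_le hs h2) (not_le.2 hc)
  obtain ⟨r, hr, hr0⟩ := h1
  have hrl : r = ilast := by
    by_contra h3
    exact hr0 (hne r hr h3)
  subst hrl
  have h4 := sum_classSum D x s
  rw [hsum, ← Finset.add_sum_erase _ _ hr] at h4
  have h5 : ∑ r' ∈ (leaders D x).erase r, classSum D x s r' = 0 :=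
    Finset.sum_eq_zero fun r' hr' =>
      hne r' (Finset.mem_of_mem_erase hr') (Finset.ne_of_mem_erase hr')
  rw [h5, add_zero] at h4
  exact hr0 h4

/-! ### The count -/

/-- The **pivot**: the first leader other than `ilast` with non-zero class sum, if any (else
`ilast`). [folklore] -/
def pivot (D : ℤ) (x : Fin m → ℤ) (s : Fin m → ℤ) (ilast : Fin m) : Fin m :=
  if h : (univ.filter fun r => r ∈ leaders D x ∧ r ≠ ilast ∧ classSum D x s r ≠ 0).Nonempty then
    (univ.filter fun r => r ∈ leaders D x ∧ r ≠ ilast ∧ classSum D x s r ≠ 0).min' h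
  else ilast

/-- If the pivot is not `ilast`, it is a leader with non-zero class sum. [folklore] -/
theorem pivot_spec {D : ℤ} {x : Fin m → ℤ} {s : Fin m → ℤ} {ilast : Fin m}
    (h : pivot D x s ilast ≠ ilast) :
    pivot D x s ilast ∈ leaders D x ∧ classSum D x s (pivot D x s ilast) ≠ 0 := by
  unfold pivot at h ⊢
  split_ifs at h ⊢ with hne
  · have hmem := Finset.min'_mem _ hne
    simp only [Finset.mem_filter, Finset.mem_univ, true_and] at hmem
    exact ⟨hmem.1, hmem.2.2⟩
  · exact absurd rfl h

/-- If some leader other than `ilast` has non-zero class sum, the pivot is not `ilast`.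
[folklore] -/
theorem pivot_ne {D : ℤ} {x : Fin m → ℤ} {s : Fin m → ℤ} {ilast : Fin m}
    (h : ∃ r ∈ leaders D x, r ≠ ilast ∧ classSum D x s r ≠ 0) :
    pivot D x s ilast ≠ ilast := by
  have hne : (univ.filter fun r => r ∈ leaders D x ∧ r ≠ ilast ∧ classSum D x s r ≠ 0).Nonempty := by
    obtain ⟨r, hr, h1, h2⟩ := h
    exact ⟨r, by simp [hr, h1, h2]⟩
  unfold pivot
  rw [dif_pos hne]
  have hmem := Finset.min'_mem _ hne
  simp only [Finset.mem_filter, Finset.mem_univ, true_and] at hmem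
  exact hmem.2.1

/-- The **free leaders**: all leaders except `ilast` and the pivot. [folklore] -/
def freeSet (D : ℤ) (x : Fin m → ℤ) (s : Fin m → ℤ) (ilast : Fin m) : Finset (Fin m) :=
  leaders D x \ {ilast, pivot D x s ilast}

/-- The combinatorial **data** of `x`: leaders, leaderRoot map, offsets to the roots, pivot.
[folklore] -/
def dataOf (D : ℤ) (x : Fin m → ℤ) (s : Fin m → ℤ) (ilast : Fin m) :
    Finset (Fin m) × (Fin m → Fin m) × (Fin m → ℤ) × Fin m :=
  (leaders D x, leaderRoot D x, fun i => x i - x (leaderRoot D x i), pivot D x s ilast)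

/-- The **free part** of `x`: its values on the free leaders (zero elsewhere). [folklore] -/
def freePart (D : ℤ) (x : Fin m → ℤ) (s : Fin m → ℤ) (ilast : Fin m) : Fin m → ℤ :=
  fun i => if i ∈ freeSet D x s ilast then x i else 0

/-- Resolution of the balance relation through the roots:
`∑ sᵢ xᵢ = ∑_{r leader} α_r x_r + ∑ sᵢ (xᵢ - x_{leaderRoot i})`. [folklore] -/
theorem balance_eq (D : ℤ) (x : Fin m → ℤ) (s : Fin m → ℤ) :
    ∑ i, s i * x i =
      ∑ r ∈ leaders D x, classSum D x s r * x r + ∑ i, s i * (x i - x (leaderRoot D x i)) := by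
  have h1 : ∑ i, s i * x i = ∑ i, s i * x (leaderRoot D x i) + ∑ i, s i * (x i - x (leaderRoot D x i)) := by
    rw [← Finset.sum_add_distrib]
    exact Finset.sum_congr rfl fun i _ => by ring
  rw [h1]
  congr 1
  rw [sum_eq_sum_leaders_sum_class D x (fun i => s i * x (leaderRoot D x i))]
  refine Finset.sum_congr rfl fun r _ => ?_
  unfold classSum
  rw [Finset.sum_mul]
  refine Finset.sum_congr rfl fun i hi => ?_
  rw [(Finset.mem_filter.1 hi).2]

/-- **Injectivity of the encoding**: two balanced vectors with the same pinned value, the same data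
and the same free part coincide. [cite: LichtmanTeravainen2022, Proposition 2.7 (proof)] -/
theorem eq_of_dataOf_eq {D : ℤ} {s : Fin m → ℤ} {ilast : Fin m} {x x' : Fin m → ℤ}
    (hbal : ∑ i, s i * x i = 0) (hbal' : ∑ i, s i * x' i = 0) (hpin : x ilast = x' ilast)
    (hdata : dataOf D x s ilast = dataOf D x' s ilast)
    (hfree : freePart D x s ilast = freePart D x' s ilast) : x = x' := by
  simp only [dataOf, Prod.mk.injEq] at hdata
  obtain ⟨hR, hroot, hE, hpiv⟩ := hdata
  have hclass : ∀ r, classSum D x s r = classSum D x' s r := fun r => by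
    unfold classSum; rw [hroot]
  have hfreeSet : freeSet D x s ilast = freeSet D x' s ilast := by
    unfold freeSet; rw [hR, hpiv]
  -- Step 1: agreement on the leaders other than the pivot
  have step1 : ∀ r ∈ leaders D x, r ≠ pivot D x s ilast → x r = x' r := by
    intro r hr hrp
    by_cases hrl : r = ilast
    · rw [hrl]; exact hpin
    · have hrF : r ∈ freeSet D x s ilast := by
        simp only [freeSet, Finset.mem_sdiff, Finset.mem_insert, Finset.mem_singleton, not_or]
        exact ⟨hr, hrl, hrp⟩
      have h1 := congrFun hfree r
      simp only [freePart] at h1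
      rw [if_pos hrF, ← hfreeSet, if_pos hrF] at h1
      exact h1
  -- Step 2: agreement at the pivot
  have step2 : x (pivot D x s ilast) = x' (pivot D x s ilast) := by
    by_cases hp : pivot D x s ilast = ilast
    · rw [hp]; exact hpin
    · obtain ⟨hpl, hpc⟩ := pivot_spec hp
      have hb := balance_eq D x s
      have hb' := balance_eq D x' s
      rw [hbal] at hb
      rw [hbal'] at hb'
      have hEsum : ∑ i, s i * (x i - x (leaderRoot D x i)) = ∑ i, s i * (x' i - x' (leaderRoot D x' i)) := by
        refine Finset.sum_congr rfl fun i _ => ?_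
        have h1 : x i - x (leaderRoot D x i) = x' i - x' (leaderRoot D x' i) := congrFun hE i
        rw [h1]
      have hlead : ∑ r ∈ leaders D x, classSum D x s r * x r =
          ∑ r ∈ leaders D x, classSum D x s r * x' r := by
        have h2 : ∑ r ∈ leaders D x', classSum D x' s r * x' r =
            ∑ r ∈ leaders D x, classSum D x s r * x' r := by
          rw [← hR]
          exact Finset.sum_congr rfl fun r _ => by rw [hclass]
        linarith [hb, hb', hEsum, h2]
      rw [← Finset.add_sum_erase _ _ hpl, ← Finset.add_sum_erase _ _ hpl] at hlead
      have h3 : ∑ r ∈ (leaders D x).erase (pivot D x s ilast), classSum D x s r * x r =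
          ∑ r ∈ (leaders D x).erase (pivot D x s ilast), classSum D x s r * x' r :=
        Finset.sum_congr rfl fun r hr => by
          rw [step1 r (Finset.mem_of_mem_erase hr) (Finset.ne_of_mem_erase hr)]
      rw [h3, add_left_inj] at hlead
      exact mul_left_cancel₀ hpc hlead
  -- Step 3: agreement on all leaders, then everywhere
  have step3 : ∀ r ∈ leaders D x, x r = x' r := by
    intro r hr
    by_cases hrp : r = pivot D x s ilast
    · rw [hrp]; exact step2
    · exact step1 r hr hrp
  funext i
  have h1 : x i - x (leaderRoot D x i) = x' i - x' (leaderRoot D x' i) := congrFun hE i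
  have h2 := step3 (leaderRoot D x i) (leaderRoot_mem_leaders D x i)
  rw [hroot] at h2
  have h3 : leaderRoot D x i = leaderRoot D x' i := by rw [hroot]
  rw [h3] at h1
  linarith

/-- The size of the free set: `#leaders - 1`, and `#leaders - 2` when `m < 2 · #leaders`
(balanced `±1` signs). [cite: LichtmanTeravainen2022, Proposition 2.7 (proof)] -/
theorem card_freeSet_le {D : ℤ} {x : Fin m → ℤ} {s : Fin m → ℤ} (hs : ∀ i, s i = 1 ∨ s i = -1)
    (hsum : ∑ i, s i = 0) {ilast : Fin m} (hlast : ∀ i, i ≤ ilast) :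
    #(freeSet D x s ilast) ≤
      #(leaders D x) - 1 - if m < 2 * #(leaders D x) then 1 else 0 := by
  have hil : ilast ∈ leaders D x := mem_leaders_of_forall_le hlast
  unfold freeSet
  split_ifs with hc
  · have hp : pivot D x s ilast ≠ ilast := pivot_ne (exists_classSum_ne_zero hs hsum ilast hc)
    have hpl : pivot D x s ilast ∈ leaders D x := (pivot_spec hp).1
    have hsub : ({ilast, pivot D x s ilast} : Finset (Fin m)) ⊆ leaders D x := by
      intro r hr
      simp only [Finset.mem_insert, Finset.mem_singleton] at hr
      rcases hr with rfl | rfl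
      · exact hil
      · exact hpl
    rw [Finset.card_sdiff_of_subset hsub, Finset.card_pair hp.symm]
    omega
  · have hsub : ({ilast} : Finset (Fin m)) ⊆ leaders D x := by
      intro r hr
      simp only [Finset.mem_singleton] at hr
      rw [hr]; exact hil
    calc #(leaders D x \ {ilast, pivot D x s ilast}) ≤ #(leaders D x \ {ilast}) := by
          refine Finset.card_le_card (Finset.sdiff_subset_sdiff le_rfl ?_)
          simp
      _ = #(leaders D x) - 1 := by rw [Finset.card_sdiff_of_subset hsub, Finset.card_singleton]
      _ = #(leaders D x) - 1 - 0 := by omega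

/-- The free part vanishes off the free set and takes the values of `x` on it. [folklore] -/
theorem freePart_mem_piFinset {D : ℤ} {x : Fin m → ℤ} {s : Fin m → ℤ} {ilast : Fin m} {B : ℕ}
    (hx : x ∈ Fintype.piFinset fun _ : Fin m => Icc (1 : ℤ) B) :
    freePart D x s ilast ∈ Fintype.piFinset fun i : Fin m =>
      if i ∈ freeSet D x s ilast then Icc (0 : ℤ) B else {0} := by
  rw [Fintype.mem_piFinset] at hx ⊢
  intro i
  simp only [freePart]
  split_ifs with h
  · have := hx i
    rw [Finset.mem_Icc] at this ⊢
    exact ⟨by linarith [this.1], this.2⟩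
  · simp

/-- The number of functions supported on `F` with values in `[0, B]` is `(B + 1)^{#F}`.
[folklore] -/
theorem card_piFinset_support (F : Finset (Fin m)) (B : ℕ) :
    #(Fintype.piFinset fun i : Fin m => if i ∈ F then Icc (0 : ℤ) B else {0}) = (B + 1) ^ #F := by
  rw [Fintype.card_piFinset]
  have h1 : ∀ i, #(if i ∈ F then Icc (0 : ℤ) B else {0}) = if i ∈ F then B + 1 else 1 := by
    intro i
    split_ifs
    · simp
    · simp
  simp_rw [h1]
  rw [Finset.prod_ite, Finset.prod_const_one, mul_one, Finset.prod_const]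
  congr 1
  simp

/-- **The count** (the paper's "by basic linear algebra … `≪ H^{2k-2-⌈m/ℓ⌉+𝟙_{m>(k-1)ℓ}}`"):
for a `±1` sign vector `s` on `Fin m` with `∑ sᵢ = 0`, a distance `D ≥ 0` and a maximal index
`ilast`, there is `C = C(m, D)` such that for all `B`, `L₀`, `c`, the vectors `x ∈ [1, B]^m` with
`∑ sᵢ xᵢ = 0`, `x_{ilast} = L₀` and exactly `c` leaders at distance `D` number at most
`C (B + 1)^{c - 1 - 𝟙[m < 2c]}`. [cite: LichtmanTeravainen2022, Proposition 2.7 (proof)] -/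
theorem card_pinned_balanced_le (m : ℕ) {D : ℤ} (hD : 0 ≤ D) (s : Fin m → ℤ)
    (hs : ∀ i, s i = 1 ∨ s i = -1) (hsum : ∑ i, s i = 0) (ilast : Fin m)
    (hlast : ∀ i, i ≤ ilast) :
    ∃ C : ℕ, ∀ (B : ℕ) (L₀ : ℤ) (c : ℕ),
      #{x ∈ Fintype.piFinset (fun _ : Fin m => Icc (1 : ℤ) B) |
          ∑ i, s i * x i = 0 ∧ x ilast = L₀ ∧ #(leaders D x) = c} ≤
        C * (B + 1) ^ (c - 1 - if m < 2 * c then 1 else 0) := by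
  classical
  set DataSet : Finset (Finset (Fin m) × (Fin m → Fin m) × (Fin m → ℤ) × Fin m) :=
    univ ×ˢ (univ ×ˢ ((Fintype.piFinset fun _ : Fin m => Icc (-((m : ℤ) * D)) ((m : ℤ) * D)) ×ˢ
      univ)) with hDataSet
  refine ⟨#DataSet, fun B L₀ c => ?_⟩
  set S := {x ∈ Fintype.piFinset (fun _ : Fin m => Icc (1 : ℤ) B) |
      ∑ i, s i * x i = 0 ∧ x ilast = L₀ ∧ #(leaders D x) = c} with hS
  set δ : ℕ := if m < 2 * c then 1 else 0 with hδ
  -- the data map lands in `DataSet`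
  have hmaps : ∀ x ∈ S, dataOf D x s ilast ∈ DataSet := by
    intro x _
    simp only [hDataSet, dataOf, Finset.mem_product, Finset.mem_univ, true_and, and_true,
      Fintype.mem_piFinset, Finset.mem_Icc]
    intro i
    exact abs_le.1 (abs_sub_leaderRoot_le hD x i)
  -- fibrewise count
  rw [Finset.card_eq_sum_card_fiberwise hmaps]
  have hfib : ∀ d ∈ DataSet, #{x ∈ S | dataOf D x s ilast = d} ≤ (B + 1) ^ (c - 1 - δ) := by
    intro d _
    set Sd := {x ∈ S | dataOf D x s ilast = d} with hSd
    rcases Sd.eq_empty_or_nonempty with he | ⟨x₀, hx₀⟩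
    · rw [he]; simp
    · -- the free set is determined by `d`
      have hx₀S : x₀ ∈ S := (Finset.mem_filter.1 hx₀).1
      have hx₀d : dataOf D x₀ s ilast = d := (Finset.mem_filter.1 hx₀).2
      set F := freeSet D x₀ s ilast with hF
      have hFeq : ∀ x ∈ Sd, freeSet D x s ilast = F := by
        intro x hx
        have hxd : dataOf D x s ilast = d := (Finset.mem_filter.1 hx).2
        have h1 : dataOf D x s ilast = dataOf D x₀ s ilast := by rw [hxd, hx₀d]
        simp only [dataOf, Prod.mk.injEq] at h1
        simp only [hF, freeSet]
        rw [h1.1, h1.2.2.2]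
      have hx₀c : #(leaders D x₀) = c := by
        have := (Finset.mem_filter.1 hx₀S).2
        exact this.2.2
      have hFcard : #F ≤ c - 1 - δ := by
        have := card_freeSet_le (D := D) (x := x₀) hs hsum hlast (ilast := ilast)
        rw [hx₀c] at this
        exact this
      -- injection of the fibre into the functions supported on `F`
      have hinj : Set.InjOn (fun x => freePart D x s ilast) (Sd : Set (Fin m → ℤ)) := by
        intro x hx x' hx' hfree
        have hxS : x ∈ S := (Finset.mem_filter.1 hx).1
        have hx'S : x' ∈ S := (Finset.mem_filter.1 hx').1
        have hxd : dataOf D x s ilast = d := (Finset.mem_filter.1 hx).2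
        have hx'd : dataOf D x' s ilast = d := (Finset.mem_filter.1 hx').2
        obtain ⟨-, hxb, hxp, -⟩ := Finset.mem_filter.1 hxS
        obtain ⟨-, hx'b, hx'p, -⟩ := Finset.mem_filter.1 hx'S
        exact eq_of_dataOf_eq hxb hx'b (by rw [hxp, hx'p]) (by rw [hxd, hx'd]) hfree
      have hmt : Set.MapsTo (fun x => freePart D x s ilast) (Sd : Set (Fin m → ℤ))
          (Fintype.piFinset fun i : Fin m => if i ∈ F then Icc (0 : ℤ) B else {0} :
            Finset (Fin m → ℤ)) := by
        intro x hx
        have hx' : x ∈ Sd := hx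
        have hxS : x ∈ S := (Finset.mem_filter.1 hx').1
        have hxbox := (Finset.mem_filter.1 hxS).1
        have := freePart_mem_piFinset (D := D) (s := s) (ilast := ilast) hxbox
        rw [hFeq x hx'] at this
        exact this
      calc #Sd ≤ #(Fintype.piFinset fun i : Fin m => if i ∈ F then Icc (0 : ℤ) B else {0}) :=
            Finset.card_le_card_of_injOn _ hmt hinj
        _ = (B + 1) ^ #F := card_piFinset_support F B
        _ ≤ (B + 1) ^ (c - 1 - δ) := Nat.pow_le_pow_right (by omega) hFcard
  calc ∑ d ∈ DataSet, #{x ∈ S | dataOf D x s ilast = d} ≤ ∑ d ∈ DataSet, (B + 1) ^ (c - 1 - δ) :=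
        Finset.sum_le_sum hfib
    _ = #DataSet * (B + 1) ^ (c - 1 - δ) := by rw [Finset.sum_const, smul_eq_mul]

end Literature.NumberTheory.Sieve.LichtmanTeravainen2022
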